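import Summits.MatrixMultiplication.OmegaCensus.RingMetaCyclic

/-!
# ω-census, family (b3): the GOLDEN groups `𝔽_p[ζ₅] ⋊ C₅` as a kernel-computable type (Schmidt atoms `A(p,5)`, `k = 2`)

HONEST FRAMING (pub-omega census; verbatim): lottery ticket; floor = certified bounds/negative ranges.
Census BOOKKEEPING (conjecture C9 of the cell; pub-omega stpp-1 gen 21).  The next atom family after `A(p,3)` (note
HOME/pub-omega-stpp-1-g21/ATOMS-NONNILPOTENT-C9.md): for a prime `p ≡ 4 (mod 5)` the Schmidt atom `A(p,5) = 𝔽_{p²} ⋊ μ₅` is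
`Gold p τ ⋊ ⟨ζ⟩` where `τ ∈ 𝔽_p` satisfies `τ² + τ = 1` (`τ = ζ + ζ⁻¹`), `Gold p τ = QuadraticAlgebra (ZMod p) (−1) τ = 𝔽_p[ζ]`,
`ζ = ⟨0, 1⟩`, `ζ² = τζ − 1`.  This file: the type `Gold p τ`, `gz = ζ`, the multiplication rule `(A + Bζ)·ζ = −B + (A + τB)ζ`
(`mul_gz`), the powers `ζ², ζ³ = −τ(1 + ζ), ζ⁴ = τ − ζ`, **`gz_pow_five : τ² + τ = 1 → ζ⁵ = 1`**, the `Fact` instance, finiteness and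
`|Gold p τ| = p²`, and the group `GoldCyc p τ := RCyc (Gold p τ) 5 gz` of order `5p²` (`RingMetaCyclic`), defined for EVERY `p, τ`
with `τ² + τ = 1`.  The 2-D phase-block layer for it is `QuadPhaseBlocks.lean`; the uniform theorem (Thue vector for `τ`, `√p`
errors in both coordinates since `τ·(ℤe₀ + ℤe₁) ⊆ ℤe₀ + ℤe₁`) is the successor's task.  Nothing here is progress on `ω`.
-/

namespace Summit.MatrixMultiplication.OmegaCensus

/-- `𝔽_p[ζ₅]`-model: the quadratic algebra `𝔽_p[x]/(x² − τx + 1)` (`x² = −1 + τx`). [folklore] -/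
abbrev Gold (p : ℕ) (τ : ZMod p) : Type := QuadraticAlgebra (ZMod p) (-1) τ

namespace Gold

variable {p : ℕ} {τ : ZMod p}

/-- `ζ`. [folklore] -/
def gz : Gold p τ := ⟨0, 1⟩

/-- `(A + Bζ)·ζ = −B + (A + τB)ζ`. [folklore] -/
theorem mul_gz (A B : ZMod p) : (⟨A, B⟩ : Gold p τ) * gz = ⟨-B, A + τ * B⟩ := by
  ext <;> simp [gz]

/-- `ζ² = −1 + τζ`. [folklore] -/
theorem gz_pow_two : (gz : Gold p τ) ^ 2 = ⟨-1, τ⟩ := by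
  rw [pow_two]
  ext <;> simp [gz]

/-- `ζ³ = −τ − τζ` (using `τ² + τ = 1`). [folklore] -/
theorem gz_pow_three (hτ : τ ^ 2 + τ = 1) : (gz : Gold p τ) ^ 3 = ⟨-τ, -τ⟩ := by
  rw [pow_succ, gz_pow_two, mul_gz]
  ext
  · simp
  · simp only
    linear_combination hτ

/-- `ζ⁴ = τ − ζ` (using `τ² + τ = 1`). [folklore] -/
theorem gz_pow_four (hτ : τ ^ 2 + τ = 1) : (gz : Gold p τ) ^ 4 = ⟨τ, -1⟩ := by
  rw [pow_succ, gz_pow_three hτ, mul_gz]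
  ext
  · simp
  · simp only
    linear_combination (-1 : ZMod p) * hτ

/-- **`ζ⁵ = 1`** (using `τ² + τ = 1`). [folklore] -/
theorem gz_pow_five (hτ : τ ^ 2 + τ = 1) : (gz : Gold p τ) ^ 5 = 1 := by
  rw [pow_succ, gz_pow_four hτ, mul_gz]
  ext <;> simp <;> rfl

/-- `ζ⁵ = 1` as a `Fact` (group law of `GoldCyc`). [folklore] -/
instance fact_gz_pow_five [Fact (τ ^ 2 + τ = 1)] : Fact ((gz : Gold p τ) ^ 5 = 1) := ⟨gz_pow_five Fact.out⟩

/-- `ζ ≠ 1` (for `p > 1`): the action of `C₅` is nontrivial. [folklore] -/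
theorem gz_ne_one [Fact (1 < p)] : (gz : Gold p τ) ≠ 1 := by
  intro h
  have h1 : (gz : Gold p τ).im = (1 : Gold p τ).im := by rw [h]
  have h2 : (1 : ZMod p) = 0 := by
    have : (1 : Gold p τ).im = 0 := rfl
    rw [this] at h1
    simp [gz] at h1
  exact one_ne_zero h2

/-- `𝔽_p[ζ]` is finite (`≃ ZMod p × ZMod p`). [folklore] -/
instance [NeZero p] : Fintype (Gold p τ) := Fintype.ofEquiv _ (QuadraticAlgebra.equivProd (-1 : ZMod p) τ).symm

/-- `|𝔽_p[ζ]| = p²`. [folklore] -/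
theorem card [NeZero p] : Fintype.card (Gold p τ) = p * p := by
  rw [Fintype.ofEquiv_card, Fintype.card_prod, ZMod.card]

end Gold

/-- The golden group `𝔽_p[ζ₅] ⋊_ζ ℤ/5` (order `5p²`; the Schmidt atom `𝔽_{p²} ⋊ C₅` for `p ≡ 4 (mod 5)`). [folklore] -/
abbrev GoldCyc (p : ℕ) (τ : ZMod p) : Type := RCyc (Gold p τ) 5 Gold.gz

/-- `|𝔽_p[ζ] ⋊ ℤ/5| = 5p²`. [folklore] -/
theorem GoldCyc.card (p : ℕ) [NeZero p] (τ : ZMod p) : Fintype.card (GoldCyc p τ) = p * p * 5 := by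
  rw [RCyc.card, Gold.card]

/-- Example: `p = 19`, `τ = 4` (`16 + 4 = 20 ≡ 1`): the atom of order `1805`. [folklore] -/
instance fact_tau_19 : Fact ((4 : ZMod 19) ^ 2 + 4 = 1) := ⟨by decide⟩

/-- The golden group of order `1805 = 5·19²` is a group (instance check). [folklore] -/
example : Group (GoldCyc 19 4) := inferInstance

end Summit.MatrixMultiplication.OmegaCensus
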